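import Mathlib
import Summits.NavierStokesRegularity.NavierStokesRegularity.Theorems.FilamentSkeletonRssMatchedKernelNormalBlockSelf
import Summits.NavierStokesRegularity.NavierStokesRegularity.Theorems.FilamentSkeletonRssSelectionBoxRJRungNormalBlockDet

/-!
# Matched-core normal block, DETERMINANT: `⟪A n, m⟫⟪A m, n⟫ < ⟪A m, m⟫⟪A n, n⟫` from rotation dominance of the matched own core
# (variable cores `mc k (u) ≥ m₁`, `mc j ≤ m₂` on the rotation window)

μ-parametrised port of `SelectionBoxRJRung.normalBlock_det_pos` (`…RungNormalBlockDet`, lane 19175-p1 g8, unit core) to the matched kernel of the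
A1G cone (kit §5(d)); the kernel-free linear algebra (`det_of_rotation_dominates`, `frame_facts`, `inner_cross_sq_eq_one`, `framePart_entries`)
is imported unchanged.  Ingredients: `MatchedKernel.matched_self_normalBlock_symm_le / _anti_ge` (own core: symmetric entries `≤ E₁`,
rotation `≥ (4/3)/m₂ − E₂`), `MatchedKernel.matched_fderiv_norm_le` (partners `≤ P₀ = 8π(D + A_P)/(c_P D³)` each, core-free), frame part
`½ id − α e₃×` (`½` on the diagonal, `≤ 2|α|` antisymmetric).  Dominance hypothesis: `6 N C_κ P₀ + 2|α| + 1 < |κ_j| ((4/3)/m₂ − E₂ − 4E₁)`.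
With the box prefactor `κ_j = Γγ_j/4π` and `m₂ = O(1)` the left side is `O(1)` and the right side `≳ Γθ₀/m₂`: the thresholds for the crux
follow in the Box file.  Lane ns-filament-19175-p1 g11; `--supports stmt-NavierStokesRegularity-27849` (determinant half of `stub_normalBlock`).
HONEST FRAMING: bookkeeping about a HYPOTHETICAL filament skeleton on the NEGATIVE side of a MODEL route; nothing here bears on Navier–Stokes
regularity or blow-up.
-/

set_option linter.dupNamespace false

noncomputable section

namespace Summit.NavierStokesRegularity.NavierStokesRegularity.Theorems.MatchedKernel

open Set Function Filter MeasureTheory Real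
open Literature.Analysis.FluidPDE
open Summit.NavierStokesRegularity.NavierStokesRegularity.Theorems.SelectionBoxRJRung
open scoped InnerProductSpace Topology

/-- **Determinant condition of clause 12 from rotation dominance, MATCHED cores.**  Let `v = Σₖ κₖ Fₖ + ½ id − α e₃ × ·` be the
frame velocity of `N` filaments `Xₖ` (each `C¹`, `‖Xₖ′‖ ≤ 1`, linear growth) with matched core profiles `mc k` (continuous,
common floor `m₁ > 0`; on filament `j` also `mc j u ≤ m₂` for `|u − c| ≤ √m₂`), `x₀ = X_j c` a point on filament `j`, which is `C²`, unit-speed, with curvature `≤ κ₀` and the two-region geometry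
of `…RungNormalBlockSelf` (`κ₀ S₁ ≤ 1/2`; distance `≥ D₁` beyond `S₁`; escape `c₁|u − c| − A₁`), the other filaments at
distance `≥ D` from `x₀` with escape `c_P|u − u₀ₖ| − A_P` and coefficients `|κₖ| ≤ C_κ`.  If
`6 N C_κ P₀ + 2|α| + 1 < |κ_j| ((4/3)/m₂ − E₂ − 4E₁)` (`P₀ = 8π(D + A_P)/(c_P D³)`, `E₁ = 192πκ₀/√m₁ + 8π(D₁+A₁)/(c₁D₁³)`,
`E₂ = 416πκ₀/√m₁ + 20π(D₁+A₁)/(c₁D₁³)` as in `…MatchedKernelNormalBlockSelf`),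
then for EVERY orthonormal completion `(m, n)` of the tangent `X_j′ c`, with `A = Dv(x₀)`:
`⟪A n, m⟫ ⟪A m, n⟫ < ⟪A m, m⟫ ⟪A n, n⟫`. [folklore] -/
theorem matched_normalBlock_det_pos {N : ℕ} {X : Fin N → ℝ → EuclideanSpace ℝ (Fin 3)} {coef : Fin N → ℝ} {α : ℝ}
    {j : Fin N} {c : ℝ} {c₀ : ℝ} {C : Fin N → ℝ} {mc : Fin N → ℝ → ℝ} {m₁ m₂ : ℝ}
    (hm₁ : 0 < m₁) (hmm : ∀ k u, m₁ ≤ mc k u) (hmcc : ∀ k, Continuous (mc k))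
    (hm₂ : 0 < m₂) (hmm₂ : ∀ u, |u - c| ≤ Real.sqrt m₂ → mc j u ≤ m₂)
    (hc₀ : 0 < c₀) (hX1 : ∀ k, ContDiff ℝ 1 (X k))
    (hdX : ∀ k u, ‖deriv (X k) u‖ ≤ 1) (hgrow : ∀ k u, c₀ * |u| - C k ≤ ‖X k u‖)
    {κ₀ S₁ D₁ c₁ A₁ : ℝ} (hXj : ContDiff ℝ 2 (X j)) (hunit : ∀ u, ‖deriv (X j) u‖ = 1)
    (hκ : ∀ u, ‖deriv (deriv (X j)) u‖ ≤ κ₀) (hS₁ : κ₀ * S₁ ≤ 1 / 2) (hc₁ : 0 < c₁) (hD₁ : 0 < D₁)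
    (hA₁ : 0 ≤ A₁) (hfar : ∀ u, S₁ ≤ |u - c| → D₁ ≤ ‖X j c - X j u‖)
    (hesc : ∀ u, c₁ * |u - c| - A₁ ≤ ‖X j c - X j u‖)
    {D cP AP : ℝ} {u₀ : Fin N → ℝ} (hD : 0 < D) (hcP : 0 < cP) (hAP : 0 ≤ AP)
    (hpfar : ∀ k, k ≠ j → ∀ u, D ≤ ‖X j c - X k u‖)
    (hpesc : ∀ k, k ≠ j → ∀ u, cP * |u - u₀ k| - AP ≤ ‖X j c - X k u‖)
    {Cκ : ℝ} (hCκ0 : 0 ≤ Cκ) (hCκ : ∀ k, k ≠ j → |coef k| ≤ Cκ)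
    {m n : EuclideanSpace ℝ (Fin 3)} (hon : Orthonormal ℝ ![deriv (X j) c, m, n])
    (hbig : 6 * (N * (Cκ * (8 * Real.pi * (D + AP) / (cP * D ^ 3)))) + 2 * |α| + 1 <
      |coef j| * (4 / 3 / m₂ - (416 * Real.pi * κ₀ / Real.sqrt m₁ + 20 * Real.pi * (D₁ + A₁) / (c₁ * D₁ ^ 3)) -
        4 * (192 * Real.pi * κ₀ / Real.sqrt m₁ + 8 * Real.pi * (D₁ + A₁) / (c₁ * D₁ ^ 3)))) :
    ⟪fderiv ℝ (fun y : EuclideanSpace ℝ (Fin 3) =>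
          (∑ k, coef k • ∫ u : ℝ, ((‖y - X k u‖ ^ 2 + mc k u) ^ (3 / 2 : ℝ))⁻¹ • cross (deriv (X k) u) (y - X k u))
            + (1 / 2 : ℝ) • y - α • cross (EuclideanSpace.single 2 1) y) (X j c) n, m⟫_ℝ *
      ⟪fderiv ℝ (fun y : EuclideanSpace ℝ (Fin 3) =>
          (∑ k, coef k • ∫ u : ℝ, ((‖y - X k u‖ ^ 2 + mc k u) ^ (3 / 2 : ℝ))⁻¹ • cross (deriv (X k) u) (y - X k u))
            + (1 / 2 : ℝ) • y - α • cross (EuclideanSpace.single 2 1) y) (X j c) m, n⟫_ℝ <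
    ⟪fderiv ℝ (fun y : EuclideanSpace ℝ (Fin 3) =>
          (∑ k, coef k • ∫ u : ℝ, ((‖y - X k u‖ ^ 2 + mc k u) ^ (3 / 2 : ℝ))⁻¹ • cross (deriv (X k) u) (y - X k u))
            + (1 / 2 : ℝ) • y - α • cross (EuclideanSpace.single 2 1) y) (X j c) m, m⟫_ℝ *
      ⟪fderiv ℝ (fun y : EuclideanSpace ℝ (Fin 3) =>
          (∑ k, coef k • ∫ u : ℝ, ((‖y - X k u‖ ^ 2 + mc k u) ^ (3 / 2 : ℝ))⁻¹ • cross (deriv (X k) u) (y - X k u))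
            + (1 / 2 : ℝ) • y - α • cross (EuclideanSpace.single 2 1) y) (X j c) n, n⟫_ℝ := by
  obtain ⟨ht, hm, hn, htm, htn, hmn⟩ := frame_facts hon
  -- the fields and their derivatives at `x₀ = X j c`
  obtain ⟨F, hF⟩ : ∃ F : Fin N → EuclideanSpace ℝ (Fin 3) → EuclideanSpace ℝ (Fin 3), F = fun k y =>
      ∫ u : ℝ, ((‖y - X k u‖ ^ 2 + mc k u) ^ (3 / 2 : ℝ))⁻¹ • cross (deriv (X k) u) (y - X k u) := ⟨_, rfl⟩
  have hdiff : ∀ k, Differentiable ℝ (F k) := fun k => by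
    have h := matchedBiotSavart_differentiable hm₁ (hmm k) (hmcc k) hc₀ (hX1 k) (hdX k) (hgrow k)
    rw [hF]; exact h
  obtain ⟨L, hL⟩ : ∃ L : Fin N → (EuclideanSpace ℝ (Fin 3) →L[ℝ] EuclideanSpace ℝ (Fin 3)),
      L = fun k => fderiv ℝ (F k) (X j c) := ⟨_, rfl⟩
  set Lrot : EuclideanSpace ℝ (Fin 3) →L[ℝ] EuclideanSpace ℝ (Fin 3) :=
    crossCLM (EuclideanSpace.single (2 : Fin 3) (1 : ℝ)) with hLrot
  set M : EuclideanSpace ℝ (Fin 3) →L[ℝ] EuclideanSpace ℝ (Fin 3) :=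
    (1 / 2 : ℝ) • ContinuousLinearMap.id ℝ _ - α • Lrot with hM
  have hMapp : ∀ y, M y = (1 / 2 : ℝ) • y - α • cross (EuclideanSpace.single 2 1) y := fun y => by
    simp [hM, hLrot]
  have hsum : HasFDerivAt (fun y : EuclideanSpace ℝ (Fin 3) => ∑ k, coef k • F k y)
      (∑ k, coef k • L k) (X j c) := by
    rw [hL]; exact HasFDerivAt.fun_sum fun k _ => (((hdiff k) (X j c)).hasFDerivAt).const_smul (coef k)
  have hlin : HasFDerivAt (fun y : EuclideanSpace ℝ (Fin 3) =>
      (1 / 2 : ℝ) • y - α • cross (EuclideanSpace.single 2 1) y) M (X j c) := by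
    have hf : (fun y : EuclideanSpace ℝ (Fin 3) => (1 / 2 : ℝ) • y - α • cross (EuclideanSpace.single 2 1) y) =
        fun y => M y := funext fun y => (hMapp y).symm
    rw [hf]; exact M.hasFDerivAt
  have hfd : fderiv ℝ (fun y : EuclideanSpace ℝ (Fin 3) =>
        (∑ k, coef k • F k y) + ((1 / 2 : ℝ) • y - α • cross (EuclideanSpace.single 2 1) y)) (X j c) =
      (∑ k, coef k • L k) + M := (hsum.add hlin).fderiv
  have hfun : (fun y : EuclideanSpace ℝ (Fin 3) =>
        (∑ k, coef k • ∫ u : ℝ, ((‖y - X k u‖ ^ 2 + mc k u) ^ (3 / 2 : ℝ))⁻¹ • cross (deriv (X k) u) (y - X k u))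
          + (1 / 2 : ℝ) • y - α • cross (EuclideanSpace.single 2 1) y) =
      fun y => (∑ k, coef k • F k y) + ((1 / 2 : ℝ) • y - α • cross (EuclideanSpace.single 2 1) y) := by
    funext y; simp only [hF]; abel
  rw [hfun, hfd]
  -- entries of the block
  have hentry : ∀ h l : EuclideanSpace ℝ (Fin 3), ⟪((∑ k, coef k • L k) + M) h, l⟫_ℝ =
      coef j * ⟪L j h, l⟫_ℝ + (∑ k ∈ Finset.univ.erase j, coef k * ⟪L k h, l⟫_ℝ) +
        ⟪(1 / 2 : ℝ) • h - α • cross (EuclideanSpace.single 2 1) h, l⟫_ℝ := by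
    intro h l
    have happly : ((∑ k, coef k • L k) + M) h = (∑ k, coef k • L k h) + M h := by simp
    rw [happly, hMapp, inner_add_left, sum_inner]
    have hterm : ∀ k, ⟪coef k • L k h, l⟫_ℝ = coef k * ⟪L k h, l⟫_ℝ := fun k => real_inner_smul_left _ _ _
    simp_rw [hterm]
    rw [← Finset.add_sum_erase _ _ (Finset.mem_univ j)]
  -- partner bound
  obtain ⟨P₀, hP₀⟩ : ∃ P₀ : ℝ, P₀ = 8 * Real.pi * (D + AP) / (cP * D ^ 3) := ⟨_, rfl⟩
  have hP₀nn : 0 ≤ P₀ := by rw [hP₀]; positivity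
  have hLk : ∀ k, k ≠ j → ‖L k‖ ≤ P₀ := fun k hk => by
    have h := matched_fderiv_norm_le (y := X j c) hm₁ (hmm k) (hmcc k) hc₀ (hX1 k) (hdX k) (hgrow k) hcP hD hAP
      (hpfar k hk) (hpesc k hk)
    rw [hL, hP₀, hF]; exact h
  have hterm_le : ∀ k, k ≠ j → ∀ h l : EuclideanSpace ℝ (Fin 3), ‖h‖ = 1 → ‖l‖ = 1 →
      |coef k * ⟪L k h, l⟫_ℝ| ≤ Cκ * P₀ := by
    intro k hk h l hh hl
    rw [abs_mul]
    have h1 : |⟪L k h, l⟫_ℝ| ≤ P₀ := by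
      calc |⟪L k h, l⟫_ℝ| ≤ ‖L k h‖ * ‖l‖ := abs_real_inner_le_norm _ _
        _ ≤ (‖L k‖ * ‖h‖) * ‖l‖ := mul_le_mul_of_nonneg_right ((L k).le_opNorm h) (norm_nonneg _)
        _ = ‖L k‖ := by rw [hh, hl, mul_one, mul_one]
        _ ≤ P₀ := hLk k hk
    exact mul_le_mul (hCκ k hk) h1 (abs_nonneg _) ((abs_nonneg _).trans (hCκ k hk))
  obtain ⟨Pv, hPv⟩ : ∃ Pv : ℝ, Pv = N * (Cκ * P₀) := ⟨_, rfl⟩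
  have hS : ∀ h l : EuclideanSpace ℝ (Fin 3), ‖h‖ = 1 → ‖l‖ = 1 →
      |∑ k ∈ Finset.univ.erase j, coef k * ⟪L k h, l⟫_ℝ| ≤ Pv := by
    intro h l hh hl
    have h1 : |∑ k ∈ Finset.univ.erase j, coef k * ⟪L k h, l⟫_ℝ| ≤
        ∑ k ∈ Finset.univ.erase j, |coef k * ⟪L k h, l⟫_ℝ| := Finset.abs_sum_le_sum_abs _ _
    have h2 : ∑ k ∈ Finset.univ.erase j, |coef k * ⟪L k h, l⟫_ℝ| ≤ (Finset.univ.erase j).card • (Cκ * P₀) :=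
      Finset.sum_le_card_nsmul _ _ _ fun k hk => hterm_le k (Finset.ne_of_mem_erase hk) h l hh hl
    rw [nsmul_eq_mul] at h2
    have hCP : 0 ≤ Cκ * P₀ := mul_nonneg hCκ0 hP₀nn
    have h3 : ((Finset.univ.erase j).card : ℝ) * (Cκ * P₀) ≤ N * (Cκ * P₀) := by
      have hc : ((Finset.univ.erase j).card : ℝ) ≤ N := by
        have := Finset.card_erase_le (s := Finset.univ) (a := j)
        rw [Finset.card_univ, Fintype.card_fin] at this
        exact_mod_cast this
      exact mul_le_mul_of_nonneg_right hc hCP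
    rw [hPv]; linarith
  have hPvnn : 0 ≤ Pv := by rw [hPv]; exact mul_nonneg (Nat.cast_nonneg N) (mul_nonneg hCκ0 hP₀nn)
  -- self bounds
  obtain ⟨E₁, hE₁⟩ : ∃ E₁ : ℝ, E₁ = 192 * Real.pi * κ₀ / Real.sqrt m₁ + 8 * Real.pi * (D₁ + A₁) / (c₁ * D₁ ^ 3) := ⟨_, rfl⟩
  obtain ⟨E₂, hE₂⟩ : ∃ E₂ : ℝ, E₂ = 416 * Real.pi * κ₀ / Real.sqrt m₁ + 20 * Real.pi * (D₁ + A₁) / (c₁ * D₁ ^ 3) := ⟨_, rfl⟩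
  have hmt : ⟪m, deriv (X j) c⟫_ℝ = 0 := by rw [real_inner_comm, htm]
  have hnt : ⟪n, deriv (X j) c⟫_ℝ = 0 := by rw [real_inner_comm, htn]
  have hLj : L j = fderiv ℝ (fun y : EuclideanSpace ℝ (Fin 3) => ∫ u : ℝ,
      ((‖y - X j u‖ ^ 2 + mc j u) ^ (3 / 2 : ℝ))⁻¹ • cross (deriv (X j) u) (y - X j u)) (X j c) := by rw [hL, hF]
  have hsymm := fun (h l : EuclideanSpace ℝ (Fin 3)) (hh : ‖h‖ = 1) (hl : ‖l‖ = 1)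
      (hht : ⟪h, deriv (X j) c⟫_ℝ = 0) (hlt : ⟪l, deriv (X j) c⟫_ℝ = 0) =>
    matched_self_normalBlock_symm_le hm₁ (hmm j) (hmcc j) hXj hunit hκ hc₀ (hgrow j) hS₁ hc₁ hD₁ hA₁ hfar hesc hh hl hht hlt
  have hamm : |⟪L j m, m⟫_ℝ| ≤ E₁ := by
    have h := hsymm m m hm hm hmt hmt
    rw [← hLj, ← hE₁] at h
    have : ⟪L j m, m⟫_ℝ + ⟪L j m, m⟫_ℝ = 2 * ⟪L j m, m⟫_ℝ := by ring
    rw [this, abs_mul, abs_two] at h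
    linarith
  have hann : |⟪L j n, n⟫_ℝ| ≤ E₁ := by
    have h := hsymm n n hn hn hnt hnt
    rw [← hLj, ← hE₁] at h
    have : ⟪L j n, n⟫_ℝ + ⟪L j n, n⟫_ℝ = 2 * ⟪L j n, n⟫_ℝ := by ring
    rw [this, abs_mul, abs_two] at h
    linarith
  have hsnm : |⟪L j n, m⟫_ℝ + ⟪L j m, n⟫_ℝ| ≤ 2 * E₁ := by
    have h := hsymm n m hn hm hnt hmt
    rw [← hLj, ← hE₁] at h
    exact h
  have hrnm : 4 / 3 / m₂ - E₂ ≤ |⟪L j n, m⟫_ℝ - ⟪L j m, n⟫_ℝ| := by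
    have h := matched_self_normalBlock_anti_ge hm₁ (hmm j) (hmcc j) hm₂ hmm₂ hXj hunit hκ hc₀ (hgrow j) hS₁ hc₁ hD₁ hA₁
      hfar hesc hm hn hmt hnt
    rw [← hLj, ← hE₂, inner_cross_sq_eq_one hon, mul_one] at h
    have hσ : |⟪deriv (X j) c, cross n m⟫_ℝ| = 1 := by
      have h1 := inner_cross_sq_eq_one hon
      rw [← sq_abs] at h1
      exact (pow_eq_one_iff_of_nonneg (abs_nonneg _) two_ne_zero).1 h1
    have h2 := le_abs_self (⟪deriv (X j) c, cross n m⟫_ℝ * (⟪L j n, m⟫_ℝ - ⟪L j m, n⟫_ℝ))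
    rw [abs_mul, hσ, one_mul] at h2
    linarith
  -- frame part
  obtain ⟨hMmm, hMnn, hMsum, hMdiff⟩ := framePart_entries α hm hn hmn
  -- the four entries
  rw [hentry n m, hentry m n, hentry m m, hentry n n]
  have hSmm := hS m m hm hm
  have hSnn := hS n n hn hn
  have hSnm := hS n m hn hm
  have hSmn := hS m n hm hn
  obtain ⟨Q, hQ⟩ : ∃ Q : ℝ, Q = |coef j| := ⟨_, rfl⟩
  have hQnn : 0 ≤ Q := by rw [hQ]; exact abs_nonneg _
  have hbig' : 6 * Pv + 2 * |α| + 1 < Q * (4 / 3 / m₂ - E₂ - 4 * E₁) := by rw [hPv, hQ, hE₁, hE₂, hP₀]; exact hbig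
  refine det_of_rotation_dominates (Abar := Q * E₁ + Pv + 1 / 2) ?_ ?_ ?_
  · -- `|a| ≤ Ā`
    rw [hMmm]
    have h1 : |coef j * ⟪L j m, m⟫_ℝ| ≤ Q * E₁ := by rw [abs_mul, hQ]; exact mul_le_mul_of_nonneg_left hamm (abs_nonneg _)
    calc _ ≤ |coef j * ⟪L j m, m⟫_ℝ + ∑ k ∈ Finset.univ.erase j, coef k * ⟪L k m, m⟫_ℝ| + |(1 / 2 : ℝ)| :=
          abs_add_le _ _
      _ ≤ (|coef j * ⟪L j m, m⟫_ℝ| + |∑ k ∈ Finset.univ.erase j, coef k * ⟪L k m, m⟫_ℝ|) + 1 / 2 := by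
          rw [abs_of_pos (by norm_num : (0:ℝ) < 1 / 2)]; exact add_le_add (abs_add_le _ _) le_rfl
      _ ≤ (Q * E₁ + Pv) + 1 / 2 := by linarith
      _ = _ := by ring
  · -- `|d| ≤ Ā`
    rw [hMnn]
    have h1 : |coef j * ⟪L j n, n⟫_ℝ| ≤ Q * E₁ := by rw [abs_mul, hQ]; exact mul_le_mul_of_nonneg_left hann (abs_nonneg _)
    calc _ ≤ |coef j * ⟪L j n, n⟫_ℝ + ∑ k ∈ Finset.univ.erase j, coef k * ⟪L k n, n⟫_ℝ| + |(1 / 2 : ℝ)| :=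
          abs_add_le _ _
      _ ≤ (|coef j * ⟪L j n, n⟫_ℝ| + |∑ k ∈ Finset.univ.erase j, coef k * ⟪L k n, n⟫_ℝ|) + 1 / 2 := by
          rw [abs_of_pos (by norm_num : (0:ℝ) < 1 / 2)]; exact add_le_add (abs_add_le _ _) le_rfl
      _ ≤ (Q * E₁ + Pv) + 1 / 2 := by linarith
      _ = _ := by ring
  · -- `|b + c| + 2Ā < |b − c|`
    have hplus : |coef j * ⟪L j n, m⟫_ℝ + (∑ k ∈ Finset.univ.erase j, coef k * ⟪L k n, m⟫_ℝ) +
          ⟪(1 / 2 : ℝ) • n - α • cross (EuclideanSpace.single 2 1) n, m⟫_ℝ +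
        (coef j * ⟪L j m, n⟫_ℝ + (∑ k ∈ Finset.univ.erase j, coef k * ⟪L k m, n⟫_ℝ) +
          ⟪(1 / 2 : ℝ) • m - α • cross (EuclideanSpace.single 2 1) m, n⟫_ℝ)| ≤ 2 * Q * E₁ + 2 * Pv := by
      have hre : coef j * ⟪L j n, m⟫_ℝ + (∑ k ∈ Finset.univ.erase j, coef k * ⟪L k n, m⟫_ℝ) +
            ⟪(1 / 2 : ℝ) • n - α • cross (EuclideanSpace.single 2 1) n, m⟫_ℝ +
          (coef j * ⟪L j m, n⟫_ℝ + (∑ k ∈ Finset.univ.erase j, coef k * ⟪L k m, n⟫_ℝ) +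
            ⟪(1 / 2 : ℝ) • m - α • cross (EuclideanSpace.single 2 1) m, n⟫_ℝ) =
          coef j * (⟪L j n, m⟫_ℝ + ⟪L j m, n⟫_ℝ) +
            ((∑ k ∈ Finset.univ.erase j, coef k * ⟪L k n, m⟫_ℝ) + ∑ k ∈ Finset.univ.erase j, coef k * ⟪L k m, n⟫_ℝ) +
            (⟪(1 / 2 : ℝ) • n - α • cross (EuclideanSpace.single 2 1) n, m⟫_ℝ +
              ⟪(1 / 2 : ℝ) • m - α • cross (EuclideanSpace.single 2 1) m, n⟫_ℝ) := by ring
      rw [hre, hMsum, add_zero]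
      have h1 : |coef j * (⟪L j n, m⟫_ℝ + ⟪L j m, n⟫_ℝ)| ≤ Q * (2 * E₁) := by
        rw [abs_mul, hQ]; exact mul_le_mul_of_nonneg_left hsnm (abs_nonneg _)
      calc _ ≤ |coef j * (⟪L j n, m⟫_ℝ + ⟪L j m, n⟫_ℝ)| +
            |(∑ k ∈ Finset.univ.erase j, coef k * ⟪L k n, m⟫_ℝ) + ∑ k ∈ Finset.univ.erase j, coef k * ⟪L k m, n⟫_ℝ| :=
            abs_add_le _ _
        _ ≤ Q * (2 * E₁) + (Pv + Pv) := add_le_add h1 ((abs_add_le _ _).trans (add_le_add hSnm hSmn))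
        _ = _ := by ring
    have hminus : Q * (4 / 3 / m₂ - E₂) - 2 * Pv - 2 * |α| ≤
        |coef j * ⟪L j n, m⟫_ℝ + (∑ k ∈ Finset.univ.erase j, coef k * ⟪L k n, m⟫_ℝ) +
          ⟪(1 / 2 : ℝ) • n - α • cross (EuclideanSpace.single 2 1) n, m⟫_ℝ -
        (coef j * ⟪L j m, n⟫_ℝ + (∑ k ∈ Finset.univ.erase j, coef k * ⟪L k m, n⟫_ℝ) +
          ⟪(1 / 2 : ℝ) • m - α • cross (EuclideanSpace.single 2 1) m, n⟫_ℝ)| := by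
      have hre : coef j * ⟪L j n, m⟫_ℝ + (∑ k ∈ Finset.univ.erase j, coef k * ⟪L k n, m⟫_ℝ) +
            ⟪(1 / 2 : ℝ) • n - α • cross (EuclideanSpace.single 2 1) n, m⟫_ℝ -
          (coef j * ⟪L j m, n⟫_ℝ + (∑ k ∈ Finset.univ.erase j, coef k * ⟪L k m, n⟫_ℝ) +
            ⟪(1 / 2 : ℝ) • m - α • cross (EuclideanSpace.single 2 1) m, n⟫_ℝ) =
          coef j * (⟪L j n, m⟫_ℝ - ⟪L j m, n⟫_ℝ) +
            (((∑ k ∈ Finset.univ.erase j, coef k * ⟪L k n, m⟫_ℝ) - ∑ k ∈ Finset.univ.erase j, coef k * ⟪L k m, n⟫_ℝ) +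
            (⟪(1 / 2 : ℝ) • n - α • cross (EuclideanSpace.single 2 1) n, m⟫_ℝ -
              ⟪(1 / 2 : ℝ) • m - α • cross (EuclideanSpace.single 2 1) m, n⟫_ℝ)) := by ring
      rw [hre]
      have h1 : Q * (4 / 3 / m₂ - E₂) ≤ |coef j * (⟪L j n, m⟫_ℝ - ⟪L j m, n⟫_ℝ)| := by
        rw [abs_mul, hQ]; exact mul_le_mul_of_nonneg_left hrnm (abs_nonneg _)
      have h2 : |((∑ k ∈ Finset.univ.erase j, coef k * ⟪L k n, m⟫_ℝ) -
              ∑ k ∈ Finset.univ.erase j, coef k * ⟪L k m, n⟫_ℝ) +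
            (⟪(1 / 2 : ℝ) • n - α • cross (EuclideanSpace.single 2 1) n, m⟫_ℝ -
              ⟪(1 / 2 : ℝ) • m - α • cross (EuclideanSpace.single 2 1) m, n⟫_ℝ)| ≤ (Pv + Pv) + 2 * |α| :=
        (abs_add_le _ _).trans (add_le_add ((abs_sub _ _).trans (add_le_add hSnm hSmn)) hMdiff)
      have h3 := abs_sub_abs_le_abs_add (coef j * (⟪L j n, m⟫_ℝ - ⟪L j m, n⟫_ℝ))
        (((∑ k ∈ Finset.univ.erase j, coef k * ⟪L k n, m⟫_ℝ) - ∑ k ∈ Finset.univ.erase j, coef k * ⟪L k m, n⟫_ℝ) +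
          (⟪(1 / 2 : ℝ) • n - α • cross (EuclideanSpace.single 2 1) n, m⟫_ℝ -
            ⟪(1 / 2 : ℝ) • m - α • cross (EuclideanSpace.single 2 1) m, n⟫_ℝ))
      linarith
    have hE₁nn : 0 ≤ Q * E₁ := mul_nonneg hQnn ((abs_nonneg _).trans hamm)
    linarith

end Summit.NavierStokesRegularity.NavierStokesRegularity.Theorems.MatchedKernel
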